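import Literature.MeasureTheory.Group.InvariantQuotientAdaptedUnfoldingBound      -- ★ p849197 (F0P3a-p09): `integrable_descConj_of_measure_preimage_lt_top`
import Literature.NumberTheory.Rogawski1990.UnipotentOrbitalMeasuresExistCM        -- ★ p849138 (LH3-p02): carrier vocabulary (`cmDatum … .Local`, `cmLocalIntegralLevel`, `IsLocSmooth`, `descConj`, `𝒪`)
import Literature.NumberTheory.Rogawski1990.UnitaryThreeUnipotentStrataCM          -- ★ p849223 (LH4-p01): `T = 1` frame idioms (ED. 2 §2)
import Literature.NumberTheory.Automorphic.UnitaryThreeRegularUnipotentClass         -- ★ `exists_conj_coe_eq_regularUnipotentNormalForm` (ED. 2 §2)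
import Literature.MeasureTheory.Group.OrbitalFinitenessTransport                    -- ★ p849303 (LH10-p01): Rao finiteness transports along `IsConj` (ED. 2 §3)
import Literature.NumberTheory.Rogawski1990.UnipotentOrbitShellsRegularCM            -- ★ (A) LH5-p02: `UnitaryGroup.exists_shells_of_regular_unipotent` (ED. 3 §4)
import Literature.MeasureTheory.Group.InvariantQuotientShellSum                     -- ★ (B) p849341 LH4-p03: `measure_biUnion_image_mk_mul_lt_top_of_shells'` (ED. 3 §4)
import Literature.NumberTheory.Automorphic.LocalUnitaryGroupUnimodularIsotropic      -- ★ `isMulRightInvariant_cmDatum_local_antidiagOne` (ED. 3 §4)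
import HarnessLib

/-!
# Convergence of the REGULAR unipotent orbital integrals of `U(Φ₃)(L⁺_v)` at an odd non-split place — the ASSEMBLY (C) of the regular case from the shell data (A)
# and the generic shell sum (B); REHEARSAL edition: (A) and (B) enter as ∀-closed hypotheses until their files are ★

Topic `NumberTheory/Rogawski1990`; namespace `Literature.NumberTheory.Rogawski1990`.  THEOREMS ONLY (no definition, no instance, no notation, no named fact, no `sorry`).
Cell `pub/hodgecm-mathlib`, crux H413 = `stmt-HodgeConjecture-24833`, line LH4 Shalika pay-down of the print row `stub_N6nsShalika`; the REGULAR CASE of the Ranga-Rao clause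
HCONV (three-way cut of LH4-plan (g2) DEALER WORDS #25∕#27, architecture of LH5-p02 (g2) 04:50:56Z): (A) LH5-p02 `UnipotentOrbitShellsRegularCM` —
`UnitaryGroup.exists_shells_of_regular_unipotent` (shell data: covering of `{y ∣ y γ y⁻¹ ∈ C}` by `K_G · x_{j,q} · C(γ)`, absorption, growth; group∕index currency);
(B) LH4-p03 `Literature/MeasureTheory/Group/InvariantQuotientShellSum` — `measure_biUnion_image_mk_mul_lt_top_of_shells` (generic: the shells have finite total mass on
`G ⧸ H`); (C) THIS FILE: `μ {y C(γ) ∣ y γ y⁻¹ ∈ C} < ∞` for every compact `C` and every invariant `μ` finite on compacta, hence (★ p849197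
`integrable_descConj_of_measure_preimage_lt_top`) the integrability of the orbital integrand of every `f ∈ C_c^∞(G)` at every REGULAR unipotent `γ` (`(γ − 1)³ = 0 ≠ (γ − 1)²`).
REHEARSAL EDITION (this file, seat LH7-p01 (g2)): (A) and (B) are the ∀-closed hypotheses `hA` ∕ `hB` (their interface texts of 04:50:56Z token for token; (B) with `H`
closed, `μ` invariant finite on compacta, `K` compact open); the FILE edition (head of record `UnitaryGroup.integrable_descConj_of_isLocSmooth_of_regular_unipotent`, LH5-p02
04:42:02Z text) replaces them by the two imports and keeps these proofs as one-line bodies.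
THE ASSEMBLY STEP (the only content here): the orbit-preimage `(descConj γ C(γ) id)⁻¹(C)` is the image in `G ⧸ C(γ)` of `{y ∣ y γ y⁻¹ ∈ C}`, (A) covers the latter by the sets
`K_G · x_{j,q} · C(γ)`, whose images are the images of `K_G · x_{j,q}` (right `C(γ)`-saturation dies under `QuotientGroup.mk`), and (B) bounds the measure of their union.
EDITION 2 (LH5-p02 (g2) 04:53:25Z ∕ DEALER WORDS #30: (A) is stated AT THE BASE POINT `ψ γ₀ = u(1, −t₀)`): §2 «WHICH CLASS» — every regular unipotent is `G`-conjugate to THE base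
point `u(1, −1∕2)` (`exists_isConj_localNonsplitEquiv_eq_regularUnipotentNormalForm`, ★ Prop. 3.9.1 pulled back through `ψ`); §3 the case head of record from the BASE-POINT
finiteness `hbase` (`UnitaryGroup.integrable_descConj_of_isLocSmooth_of_regular_unipotent_of_basePoint`, ★ p849303 transport).  EDITION 3: §4 `hbase` PROVED from ★ (A) + ★ (B)
(`UnitaryGroup.measure_preimage_descConj_lt_top_of_regular_basePoint`), the measure-level head `UnitaryGroup.measure_preimage_descConj_lt_top_of_regular_unipotent` and THE CASE HEAD OF
RECORD `UnitaryGroup.integrable_descConj_of_isLocSmooth_of_regular_unipotent := …_of_basePoint §4` — the regular case of the Ranga-Rao clause is CLOSED in-house.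
HONEST LABEL: HC_CM is proved only modulo the 7 printed citations (2 remaining: hLiu418 = stmt-HodgeConjecture-24832, h413 = stmt-HodgeConjecture-24833) until rung 0 closes; count-neutral
until the leaf TIE; nothing printed is proved here.

## References
* [Rao1972] R. Ranga Rao, *Orbital integrals in reductive groups*, Ann. of Math. (2) 96 (1972) 505–510: Theorem p. 505.
* [Rogawski1990] J. D. Rogawski, *Automorphic Representations of Unitary Groups in Three Variables*, Ann. of Math. Stud. 123 (1990): §4.9 p. 54; §8.1 p. 112.
* [HarishChandra1999AdmissibleDistributions] Harish-Chandra (DeBacker–Sally), *Admissible Invariant Distributions on Reductive p-adic Groups*, AMS ULS 16 (1999): §3.1 p. 17.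
-/

set_option autoImplicit false

noncomputable section

open MeasureTheory Measure NumberField IsDedekindDomain Topology Filter Set
open Literature.MeasureTheory.Group Literature.NumberTheory.Automorphic Literature.NumberTheory.Automorphic.UnitaryGroup Literature.NumberTheory.GaloisRepresentations
open scoped Matrix MatrixGroups ValuativeRel Pointwise WithZero

namespace Literature.NumberTheory.Rogawski1990

set_option maxHeartbeats 400000 in
-- statement-heavy: two long ∀-closed interface texts + the carrier binders
/-- **(C) REGULAR CASE, MEASURE LEVEL (rehearsal edition).**  For a REGULAR unipotent `γ ∈ U(Φ₃)(L⁺_v)` (odd non-split `v`), every `G`-invariant measure `μ` on `G ⧸ C(γ)`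
finite on compacta and every compact `C ⊆ G`: `μ {y C(γ) ∣ y γ y⁻¹ ∈ C} < ∞` — from the shell data (A) (`hA`, LH5-p02's `UnitaryGroup.exists_shells_of_regular_unipotent`) and the
generic shell sum (B) (`hB`, LH4-p03's `measure_biUnion_image_mk_mul_lt_top_of_shells`) at `H := C(γ)` (closed), `K := U(Φ₃)(𝒪_v)` (compact open, ★
`isCompact_isOpen_cmLocalIntegralLevel`). [cite: Rao1972, Theorem p. 505] [cite: Rogawski1990, §8.1 p. 112; §4.9 p. 54] [cite: HarishChandra1999AdmissibleDistributions, §3.1 p. 17] -/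
theorem UnitaryGroup.measure_preimage_descConj_lt_top_of_regular_unipotent_of_shells
    (hA : ∀ (L : Type) [Field L] [NumberField L] [IsCMField L] (v : HeightOneSpectrum (𝓞 ↥(maximalRealSubfield L))) (w : UnitaryGroup.PlacesOver L v),
      Subsingleton (UnitaryGroup.PlacesOver L v) → IsUnit (2 : 𝒪[w.1.adicCompletion L]) →
      ∀ (γ : ((cmDatum L 3 (Matrix.of fun i j : Fin 3 => if i.val + j.val + 1 = 3 then (1 : L) else 0)).Local v)), ((γ.val : GL (Fin 3) (UnitaryGroup.LocalRing L v)).val - 1) ^ 3 = 0 → ((γ.val : GL (Fin 3) (UnitaryGroup.LocalRing L v)).val - 1) ^ 2 ≠ 0 →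
      ∀ (C : Set ((cmDatum L 3 (Matrix.of fun i j : Fin 3 => if i.val + j.val + 1 = 3 then (1 : L) else 0)).Local v)), IsCompact C →
        ∃ (j₀ : ℤ) (N : ℤ → ℕ) (x : ℤ → ℕ → ((cmDatum L 3 (Matrix.of fun i j : Fin 3 => if i.val + j.val + 1 = 3 then (1 : L) else 0)).Local v)) (S : ℤ → Subgroup ↥(Subgroup.centralizer ({γ} : Set ((cmDatum L 3 (Matrix.of fun i j : Fin 3 => if i.val + j.val + 1 = 3 then (1 : L) else 0)).Local v)))) (c₃ : ℕ),
          j₀ ≤ 0 ∧ 0 < c₃ ∧ (∀ j, j₀ ≤ j → IsCompact (S j : Set ↥(Subgroup.centralizer ({γ} : Set ((cmDatum L 3 (Matrix.of fun i j : Fin 3 => if i.val + j.val + 1 = 3 then (1 : L) else 0)).Local v))))) ∧ IsOpen (S j₀ : Set ↥(Subgroup.centralizer ({γ} : Set ((cmDatum L 3 (Matrix.of fun i j : Fin 3 => if i.val + j.val + 1 = 3 then (1 : L) else 0)).Local v)))) ∧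
          (∀ j, j₀ ≤ j → S j₀ ≤ S j) ∧
          (∀ j, j₀ ≤ j → ∀ q, q < N j → ∀ k ∈ (cmLocalIntegralLevel L 3 (Matrix.of fun i j : Fin 3 => if i.val + j.val + 1 = 3 then (1 : L) else 0) v), ∀ s ∈ S j, k * x j q * (s : ((cmDatum L 3 (Matrix.of fun i j : Fin 3 => if i.val + j.val + 1 = 3 then (1 : L) else 0)).Local v)) ∈ ((cmLocalIntegralLevel L 3 (Matrix.of fun i j : Fin 3 => if i.val + j.val + 1 = 3 then (1 : L) else 0) v) : Set ((cmDatum L 3 (Matrix.of fun i j : Fin 3 => if i.val + j.val + 1 = 3 then (1 : L) else 0)).Local v)) * {x j q}) ∧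
          (∀ j, j₀ ≤ j → N j * 2 ^ ((j - 2 * j₀) / 2).toNat ≤ c₃ * (S j₀).relIndex (S j)) ∧
          {y : ((cmDatum L 3 (Matrix.of fun i j : Fin 3 => if i.val + j.val + 1 = 3 then (1 : L) else 0)).Local v) | y * γ * y⁻¹ ∈ C} ⊆ ⋃ j ∈ {j | j₀ ≤ j}, ⋃ q ∈ {q | q < N j}, ((cmLocalIntegralLevel L 3 (Matrix.of fun i j : Fin 3 => if i.val + j.val + 1 = 3 then (1 : L) else 0) v) : Set ((cmDatum L 3 (Matrix.of fun i j : Fin 3 => if i.val + j.val + 1 = 3 then (1 : L) else 0)).Local v)) * {x j q} * ((Subgroup.centralizer ({γ} : Set ((cmDatum L 3 (Matrix.of fun i j : Fin 3 => if i.val + j.val + 1 = 3 then (1 : L) else 0)).Local v))) : Set ((cmDatum L 3 (Matrix.of fun i j : Fin 3 => if i.val + j.val + 1 = 3 then (1 : L) else 0)).Local v)))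
    (hB : ∀ {G : Type} [Group G] [TopologicalSpace G] [IsTopologicalGroup G] [LocallyCompactSpace G] [SecondCountableTopology G] [T2Space G]
      [MeasurableSpace G] [BorelSpace G] (H : Subgroup G), IsClosed (H : Set G) →
      ∀ [MeasurableSpace (G ⧸ H)] [BorelSpace (G ⧸ H)] (μ : Measure (G ⧸ H)) [SMulInvariantMeasure G (G ⧸ H) μ] [IsFiniteMeasureOnCompacts μ]
      (K : Subgroup G), IsOpen (K : Set G) → IsCompact (K : Set G) →
      ∀ (j₀ : ℤ) (N : ℤ → ℕ) (x : ℤ → ℕ → G) (S : ℤ → Subgroup ↥H) (c₃ : ℕ),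
        (∀ j, j₀ ≤ j → IsCompact (S j : Set ↥H)) → IsOpen (S j₀ : Set ↥H) → (∀ j, j₀ ≤ j → S j₀ ≤ S j) →
        (∀ j, j₀ ≤ j → ∀ q, q < N j → ∀ k ∈ K, ∀ s ∈ S j, k * x j q * (s : G) ∈ (K : Set G) * {x j q}) →
        (∀ j, j₀ ≤ j → N j * 2 ^ ((j - 2 * j₀) / 2).toNat ≤ c₃ * (S j₀).relIndex (S j)) →
        μ (⋃ j ∈ {j | j₀ ≤ j}, ⋃ q ∈ {q | q < N j}, QuotientGroup.mk '' ((K : Set G) * {x j q})) < ⊤)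
    (L : Type) [Field L] [NumberField L] [IsCMField L] (v : HeightOneSpectrum (𝓞 ↥(maximalRealSubfield L))) (w : UnitaryGroup.PlacesOver L v)
    (hsub : Subsingleton (UnitaryGroup.PlacesOver L v)) (h2 : IsUnit (2 : 𝒪[w.1.adicCompletion L]))
    [MeasurableSpace ((cmDatum L 3 (Matrix.of fun i j : Fin 3 => if i.val + j.val + 1 = 3 then (1 : L) else 0)).Local v)] [BorelSpace ((cmDatum L 3 (Matrix.of fun i j : Fin 3 => if i.val + j.val + 1 = 3 then (1 : L) else 0)).Local v)]
    [∀ γ : ((cmDatum L 3 (Matrix.of fun i j : Fin 3 => if i.val + j.val + 1 = 3 then (1 : L) else 0)).Local v), MeasurableSpace (((cmDatum L 3 (Matrix.of fun i j : Fin 3 => if i.val + j.val + 1 = 3 then (1 : L) else 0)).Local v) ⧸ Subgroup.centralizer ({γ} : Set ((cmDatum L 3 (Matrix.of fun i j : Fin 3 => if i.val + j.val + 1 = 3 then (1 : L) else 0)).Local v)))]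
    [∀ γ : ((cmDatum L 3 (Matrix.of fun i j : Fin 3 => if i.val + j.val + 1 = 3 then (1 : L) else 0)).Local v), BorelSpace (((cmDatum L 3 (Matrix.of fun i j : Fin 3 => if i.val + j.val + 1 = 3 then (1 : L) else 0)).Local v) ⧸ Subgroup.centralizer ({γ} : Set ((cmDatum L 3 (Matrix.of fun i j : Fin 3 => if i.val + j.val + 1 = 3 then (1 : L) else 0)).Local v)))]
    (γ : ((cmDatum L 3 (Matrix.of fun i j : Fin 3 => if i.val + j.val + 1 = 3 then (1 : L) else 0)).Local v)) (hγ : ((γ.val : GL (Fin 3) (UnitaryGroup.LocalRing L v)).val - 1) ^ 3 = 0) (hreg : ((γ.val : GL (Fin 3) (UnitaryGroup.LocalRing L v)).val - 1) ^ 2 ≠ 0)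
    (μ : Measure (((cmDatum L 3 (Matrix.of fun i j : Fin 3 => if i.val + j.val + 1 = 3 then (1 : L) else 0)).Local v) ⧸ (Subgroup.centralizer ({γ} : Set ((cmDatum L 3 (Matrix.of fun i j : Fin 3 => if i.val + j.val + 1 = 3 then (1 : L) else 0)).Local v)))))
    [SMulInvariantMeasure ((cmDatum L 3 (Matrix.of fun i j : Fin 3 => if i.val + j.val + 1 = 3 then (1 : L) else 0)).Local v) (((cmDatum L 3 (Matrix.of fun i j : Fin 3 => if i.val + j.val + 1 = 3 then (1 : L) else 0)).Local v) ⧸ (Subgroup.centralizer ({γ} : Set ((cmDatum L 3 (Matrix.of fun i j : Fin 3 => if i.val + j.val + 1 = 3 then (1 : L) else 0)).Local v)))) μ] [IsFiniteMeasureOnCompacts μ]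
    (C : Set ((cmDatum L 3 (Matrix.of fun i j : Fin 3 => if i.val + j.val + 1 = 3 then (1 : L) else 0)).Local v)) (hC : IsCompact C) :
    μ ((descConj γ (Subgroup.centralizer ({γ} : Set ((cmDatum L 3 (Matrix.of fun i j : Fin 3 => if i.val + j.val + 1 = 3 then (1 : L) else 0)).Local v))) (fun _ hg => Subgroup.mem_centralizer_singleton_iff.1 hg) id) ⁻¹' C) < ⊤ := by
  obtain ⟨j₀, N, x, S, c₃, -, -, hSc, hS₀, hle, habs, hgr, hcov⟩ := hA L v w hsub h2 γ hγ hreg C hC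
  have hK := isCompact_isOpen_cmLocalIntegralLevel L 3 (Matrix.of fun i j : Fin 3 => if i.val + j.val + 1 = 3 then (1 : L) else 0) v
  have hH : IsClosed ((Subgroup.centralizer ({γ} : Set ((cmDatum L 3 (Matrix.of fun i j : Fin 3 => if i.val + j.val + 1 = 3 then (1 : L) else 0)).Local v))) : Set ((cmDatum L 3 (Matrix.of fun i j : Fin 3 => if i.val + j.val + 1 = 3 then (1 : L) else 0)).Local v)) :=
    Set.isClosed_centralizer _
  have hbound := hB (Subgroup.centralizer ({γ} : Set ((cmDatum L 3 (Matrix.of fun i j : Fin 3 => if i.val + j.val + 1 = 3 then (1 : L) else 0)).Local v))) hH μ (cmLocalIntegralLevel L 3 (Matrix.of fun i j : Fin 3 => if i.val + j.val + 1 = 3 then (1 : L) else 0) v) hK.2 hK.1 j₀ N x S c₃ hSc hS₀ hle habs hgr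
  refine lt_of_le_of_lt (measure_mono ?_) hbound
  intro y hy
  induction y using QuotientGroup.induction_on with
  | H g =>
    have hg : g ∈ {y : ((cmDatum L 3 (Matrix.of fun i j : Fin 3 => if i.val + j.val + 1 = 3 then (1 : L) else 0)).Local v) | y * γ * y⁻¹ ∈ C} := hy
    have hg' := hcov hg
    simp only [mem_iUnion, mem_setOf_eq, exists_prop] at hg'
    obtain ⟨j, hj, q, hq, hmem⟩ := hg'
    obtain ⟨a, ha, c, hc, rfl⟩ := Set.mem_mul.1 hmem
    simp only [mem_iUnion, mem_setOf_eq, exists_prop]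
    refine ⟨j, hj, q, hq, a, ha, ?_⟩
    exact (QuotientGroup.mk_mul_of_mem a hc).symm

set_option maxHeartbeats 400000 in
-- statement-heavy: two long ∀-closed interface texts + the carrier binders
/-- **(C) REGULAR CASE OF THE RANGA-RAO CLAUSE (rehearsal edition)** — the head `UnitaryGroup.integrable_descConj_of_isLocSmooth_of_regular_unipotent` (LH5-p02 (g2) 04:42:02Z text:
binders `(γ)(hγ)(hreg)(μ)[inv][fin](f)(hf)`) from (A) and (B): for a REGULAR unipotent `γ`, an invariant `μ` finite on compacta on `G ⧸ C(γ)` and `f ∈ C_c^∞(G)`, the orbital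
integrand `y C(γ) ↦ f(y γ y⁻¹)` is `μ`-integrable (★ p849197 `integrable_descConj_of_measure_preimage_lt_top` over `measure_preimage_descConj_lt_top_of_regular_unipotent_of_shells`).
[cite: Rao1972, Theorem p. 505] [cite: Rogawski1990, §8.1 p. 112; §4.9 p. 54] [cite: HarishChandra1999AdmissibleDistributions, §3.1 p. 17] -/
theorem UnitaryGroup.integrable_descConj_of_isLocSmooth_of_regular_unipotent_of_shells
    (hA : ∀ (L : Type) [Field L] [NumberField L] [IsCMField L] (v : HeightOneSpectrum (𝓞 ↥(maximalRealSubfield L))) (w : UnitaryGroup.PlacesOver L v),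
      Subsingleton (UnitaryGroup.PlacesOver L v) → IsUnit (2 : 𝒪[w.1.adicCompletion L]) →
      ∀ (γ : ((cmDatum L 3 (Matrix.of fun i j : Fin 3 => if i.val + j.val + 1 = 3 then (1 : L) else 0)).Local v)), ((γ.val : GL (Fin 3) (UnitaryGroup.LocalRing L v)).val - 1) ^ 3 = 0 → ((γ.val : GL (Fin 3) (UnitaryGroup.LocalRing L v)).val - 1) ^ 2 ≠ 0 →
      ∀ (C : Set ((cmDatum L 3 (Matrix.of fun i j : Fin 3 => if i.val + j.val + 1 = 3 then (1 : L) else 0)).Local v)), IsCompact C →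
        ∃ (j₀ : ℤ) (N : ℤ → ℕ) (x : ℤ → ℕ → ((cmDatum L 3 (Matrix.of fun i j : Fin 3 => if i.val + j.val + 1 = 3 then (1 : L) else 0)).Local v)) (S : ℤ → Subgroup ↥(Subgroup.centralizer ({γ} : Set ((cmDatum L 3 (Matrix.of fun i j : Fin 3 => if i.val + j.val + 1 = 3 then (1 : L) else 0)).Local v)))) (c₃ : ℕ),
          j₀ ≤ 0 ∧ 0 < c₃ ∧ (∀ j, j₀ ≤ j → IsCompact (S j : Set ↥(Subgroup.centralizer ({γ} : Set ((cmDatum L 3 (Matrix.of fun i j : Fin 3 => if i.val + j.val + 1 = 3 then (1 : L) else 0)).Local v))))) ∧ IsOpen (S j₀ : Set ↥(Subgroup.centralizer ({γ} : Set ((cmDatum L 3 (Matrix.of fun i j : Fin 3 => if i.val + j.val + 1 = 3 then (1 : L) else 0)).Local v)))) ∧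
          (∀ j, j₀ ≤ j → S j₀ ≤ S j) ∧
          (∀ j, j₀ ≤ j → ∀ q, q < N j → ∀ k ∈ (cmLocalIntegralLevel L 3 (Matrix.of fun i j : Fin 3 => if i.val + j.val + 1 = 3 then (1 : L) else 0) v), ∀ s ∈ S j, k * x j q * (s : ((cmDatum L 3 (Matrix.of fun i j : Fin 3 => if i.val + j.val + 1 = 3 then (1 : L) else 0)).Local v)) ∈ ((cmLocalIntegralLevel L 3 (Matrix.of fun i j : Fin 3 => if i.val + j.val + 1 = 3 then (1 : L) else 0) v) : Set ((cmDatum L 3 (Matrix.of fun i j : Fin 3 => if i.val + j.val + 1 = 3 then (1 : L) else 0)).Local v)) * {x j q}) ∧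
          (∀ j, j₀ ≤ j → N j * 2 ^ ((j - 2 * j₀) / 2).toNat ≤ c₃ * (S j₀).relIndex (S j)) ∧
          {y : ((cmDatum L 3 (Matrix.of fun i j : Fin 3 => if i.val + j.val + 1 = 3 then (1 : L) else 0)).Local v) | y * γ * y⁻¹ ∈ C} ⊆ ⋃ j ∈ {j | j₀ ≤ j}, ⋃ q ∈ {q | q < N j}, ((cmLocalIntegralLevel L 3 (Matrix.of fun i j : Fin 3 => if i.val + j.val + 1 = 3 then (1 : L) else 0) v) : Set ((cmDatum L 3 (Matrix.of fun i j : Fin 3 => if i.val + j.val + 1 = 3 then (1 : L) else 0)).Local v)) * {x j q} * ((Subgroup.centralizer ({γ} : Set ((cmDatum L 3 (Matrix.of fun i j : Fin 3 => if i.val + j.val + 1 = 3 then (1 : L) else 0)).Local v))) : Set ((cmDatum L 3 (Matrix.of fun i j : Fin 3 => if i.val + j.val + 1 = 3 then (1 : L) else 0)).Local v)))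
    (hB : ∀ {G : Type} [Group G] [TopologicalSpace G] [IsTopologicalGroup G] [LocallyCompactSpace G] [SecondCountableTopology G] [T2Space G]
      [MeasurableSpace G] [BorelSpace G] (H : Subgroup G), IsClosed (H : Set G) →
      ∀ [MeasurableSpace (G ⧸ H)] [BorelSpace (G ⧸ H)] (μ : Measure (G ⧸ H)) [SMulInvariantMeasure G (G ⧸ H) μ] [IsFiniteMeasureOnCompacts μ]
      (K : Subgroup G), IsOpen (K : Set G) → IsCompact (K : Set G) →
      ∀ (j₀ : ℤ) (N : ℤ → ℕ) (x : ℤ → ℕ → G) (S : ℤ → Subgroup ↥H) (c₃ : ℕ),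
        (∀ j, j₀ ≤ j → IsCompact (S j : Set ↥H)) → IsOpen (S j₀ : Set ↥H) → (∀ j, j₀ ≤ j → S j₀ ≤ S j) →
        (∀ j, j₀ ≤ j → ∀ q, q < N j → ∀ k ∈ K, ∀ s ∈ S j, k * x j q * (s : G) ∈ (K : Set G) * {x j q}) →
        (∀ j, j₀ ≤ j → N j * 2 ^ ((j - 2 * j₀) / 2).toNat ≤ c₃ * (S j₀).relIndex (S j)) →
        μ (⋃ j ∈ {j | j₀ ≤ j}, ⋃ q ∈ {q | q < N j}, QuotientGroup.mk '' ((K : Set G) * {x j q})) < ⊤)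
    (L : Type) [Field L] [NumberField L] [IsCMField L] (v : HeightOneSpectrum (𝓞 ↥(maximalRealSubfield L))) (w : UnitaryGroup.PlacesOver L v)
    (hsub : Subsingleton (UnitaryGroup.PlacesOver L v)) (h2 : IsUnit (2 : 𝒪[w.1.adicCompletion L]))
    [MeasurableSpace ((cmDatum L 3 (Matrix.of fun i j : Fin 3 => if i.val + j.val + 1 = 3 then (1 : L) else 0)).Local v)] [BorelSpace ((cmDatum L 3 (Matrix.of fun i j : Fin 3 => if i.val + j.val + 1 = 3 then (1 : L) else 0)).Local v)]
    [∀ γ : ((cmDatum L 3 (Matrix.of fun i j : Fin 3 => if i.val + j.val + 1 = 3 then (1 : L) else 0)).Local v), MeasurableSpace (((cmDatum L 3 (Matrix.of fun i j : Fin 3 => if i.val + j.val + 1 = 3 then (1 : L) else 0)).Local v) ⧸ Subgroup.centralizer ({γ} : Set ((cmDatum L 3 (Matrix.of fun i j : Fin 3 => if i.val + j.val + 1 = 3 then (1 : L) else 0)).Local v)))]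
    [∀ γ : ((cmDatum L 3 (Matrix.of fun i j : Fin 3 => if i.val + j.val + 1 = 3 then (1 : L) else 0)).Local v), BorelSpace (((cmDatum L 3 (Matrix.of fun i j : Fin 3 => if i.val + j.val + 1 = 3 then (1 : L) else 0)).Local v) ⧸ Subgroup.centralizer ({γ} : Set ((cmDatum L 3 (Matrix.of fun i j : Fin 3 => if i.val + j.val + 1 = 3 then (1 : L) else 0)).Local v)))]
    (γ : ((cmDatum L 3 (Matrix.of fun i j : Fin 3 => if i.val + j.val + 1 = 3 then (1 : L) else 0)).Local v)) (hγ : ((γ.val : GL (Fin 3) (UnitaryGroup.LocalRing L v)).val - 1) ^ 3 = 0) (hreg : ((γ.val : GL (Fin 3) (UnitaryGroup.LocalRing L v)).val - 1) ^ 2 ≠ 0)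
    (μ : Measure (((cmDatum L 3 (Matrix.of fun i j : Fin 3 => if i.val + j.val + 1 = 3 then (1 : L) else 0)).Local v) ⧸ (Subgroup.centralizer ({γ} : Set ((cmDatum L 3 (Matrix.of fun i j : Fin 3 => if i.val + j.val + 1 = 3 then (1 : L) else 0)).Local v)))))
    [SMulInvariantMeasure ((cmDatum L 3 (Matrix.of fun i j : Fin 3 => if i.val + j.val + 1 = 3 then (1 : L) else 0)).Local v) (((cmDatum L 3 (Matrix.of fun i j : Fin 3 => if i.val + j.val + 1 = 3 then (1 : L) else 0)).Local v) ⧸ (Subgroup.centralizer ({γ} : Set ((cmDatum L 3 (Matrix.of fun i j : Fin 3 => if i.val + j.val + 1 = 3 then (1 : L) else 0)).Local v)))) μ] [IsFiniteMeasureOnCompacts μ]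
    (f : ((cmDatum L 3 (Matrix.of fun i j : Fin 3 => if i.val + j.val + 1 = 3 then (1 : L) else 0)).Local v) → ℂ) (hf : IsLocSmooth f) :
    Integrable (descConj γ (Subgroup.centralizer ({γ} : Set ((cmDatum L 3 (Matrix.of fun i j : Fin 3 => if i.val + j.val + 1 = 3 then (1 : L) else 0)).Local v))) (fun _ hg => Subgroup.mem_centralizer_singleton_iff.1 hg) f) μ :=
  integrable_descConj_of_measure_preimage_lt_top γ (Subgroup.centralizer ({γ} : Set ((cmDatum L 3 (Matrix.of fun i j : Fin 3 => if i.val + j.val + 1 = 3 then (1 : L) else 0)).Local v))) (fun _ hg => Subgroup.mem_centralizer_singleton_iff.1 hg) μ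
    (fun C hC => UnitaryGroup.measure_preimage_descConj_lt_top_of_regular_unipotent_of_shells hA hB L v w hsub h2 γ hγ hreg μ C hC)
    hf.continuous hf.hasCompactSupport


/-! ## §2 (ED. 2) WHICH CLASS — every REGULAR unipotent of `U(Φ₃)(L⁺_v)` is conjugate in `G` to THE base point `ψ(γ₀) = u(1, −1∕2)` -/

section WhichClass

variable (L : Type) [Field L] [NumberField L] [IsCMField L] {v : HeightOneSpectrum (𝓞 ↥(maximalRealSubfield L))} (w : UnitaryGroup.PlacesOver L v)
  (hw : IsCMField.complexConj L • w.1 = w.1)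

set_option maxHeartbeats 400000 in
-- long coercion towers through `ψ`
/-- **WHICH CLASS — every REGULAR unipotent of `U(Φ₃)(L⁺_v)` is conjugate to THE base point `u(1, −1∕2)`.**  For `γ ∈ G` with `(γ − 1)³ = 0 ≠ (γ − 1)²` (one place `w ∣ v`,
`2 ≠ 0` in `L_w`) there is `γ₀ ∈ G` with `ψ(γ₀) = !![1, 1, −2⁻¹; 0, 1, −1; 0, 0, 1]` (BARE `ψ = localNonsplitEquiv` spelling of ★ p849314 ∕ LH5-p02's (A)) and `γ₀ ∼ γ` IN `G` — ★
Prop. 3.9.1 normal form `exists_conj_coe_eq_regularUnipotentNormalForm` in `U(σ_w, J₀)(L_w)` (★ `galAdicCompletionMap_involutive`), pulled back through the bijection `ψ` at the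
trivial frame (★ p849223 `sub_one_pow_eq_zero_iff_conj_localNonsplitEquiv`, ★ `conj_localNonsplitEquiv_mem`, ★ `exists_conj_localNonsplitEquiv_eq`, ★
`isConj_iff_exists_conj_localNonsplitEquiv`). [cite: Rogawski1990, §3.9 Prop. 3.9.1 p. 32] -/
theorem exists_isConj_localNonsplitEquiv_eq_regularUnipotentNormalForm (hsub : Subsingleton (UnitaryGroup.PlacesOver L v))
    (h2 : (2 : w.1.adicCompletion L) ≠ 0) (γ : ((cmDatum L 3 (Matrix.of fun i j : Fin 3 => if i.val + j.val + 1 = 3 then (1 : L) else 0)).Local v))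
    (hγ : ((γ.val : GL (Fin 3) (UnitaryGroup.LocalRing L v)).val - 1) ^ 3 = 0) (hreg : ((γ.val : GL (Fin 3) (UnitaryGroup.LocalRing L v)).val - 1) ^ 2 ≠ 0) :
    ∃ γ₀ : ((cmDatum L 3 (Matrix.of fun i j : Fin 3 => if i.val + j.val + 1 = 3 then (1 : L) else 0)).Local v),
      ((((localNonsplitEquiv (IsCMField.complexConj L) (Matrix.of fun i j : Fin 3 => if i.val + j.val + 1 = 3 then (1 : L) else 0) (IsCMField.complexConj_ne_one L) w hw γ₀ : ↥(unitaryGroupOfForm (galAdicCompletionMap (L := L) (IsCMField.complexConj L) hw) (placeForm (Matrix.of fun i j : Fin 3 => if i.val + j.val + 1 = 3 then (1 : L) else 0) w.1))) : GL (Fin 3) (w.1.adicCompletion L))) : Matrix (Fin 3) (Fin 3) (w.1.adicCompletion L)) = !![1, 1, -2⁻¹; 0, 1, -1; 0, 0, 1] ∧ IsConj γ₀ γ := by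
  have hσ : ∀ z : w.1.adicCompletion L, galAdicCompletionMap (L := L) (IsCMField.complexConj L) hw (galAdicCompletionMap (L := L) (IsCMField.complexConj L) hw z) = z :=
    galAdicCompletionMap_involutive L v w hw
  have hT := placeForm_antidiagOne_eq_formCongr_one L w hw
  -- `ψ γ ∈ U(σ_w, J₀)`, `(ψγ − 1)³ = 0`, `(ψγ − 1)² ≠ 0`
  have hu := conj_localNonsplitEquiv_mem L (Matrix.of fun i j : Fin 3 => if i.val + j.val + 1 = 3 then (1 : L) else 0) v w hw hT γ
  have hsq3 := (sub_one_pow_eq_zero_iff_conj_localNonsplitEquiv L w hw hsub γ 3).1 hγ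
  have hsq2 : ¬ (((((1 : GL (Fin 3) (w.1.adicCompletion L)) * ((localNonsplitEquiv (IsCMField.complexConj L) (Matrix.of fun i j : Fin 3 => if i.val + j.val + 1 = 3 then (1 : L) else 0) (IsCMField.complexConj_ne_one L) w hw γ : ↥(unitaryGroupOfForm (galAdicCompletionMap (L := L) (IsCMField.complexConj L) hw) (placeForm (Matrix.of fun i j : Fin 3 => if i.val + j.val + 1 = 3 then (1 : L) else 0) w.1))) : GL (Fin 3) (w.1.adicCompletion L)) *
        (1 : GL (Fin 3) (w.1.adicCompletion L))⁻¹ : GL (Fin 3) (w.1.adicCompletion L)) : Matrix (Fin 3) (Fin 3) (w.1.adicCompletion L)) - 1) ^ 2 = 0) :=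
    fun h => hreg ((sub_one_pow_eq_zero_iff_conj_localNonsplitEquiv L w hw hsub γ 2).2 h)
  rw [pow_two] at hsq2
  obtain ⟨k, hk, hk'⟩ := exists_conj_coe_eq_regularUnipotentNormalForm (galAdicCompletionMap (L := L) (IsCMField.complexConj L) hw) hσ h2 hu ⟨3, hsq3⟩ hsq2
  -- pull `k ψγ k⁻¹` back through `ψ`
  obtain ⟨γ₀, hγ₀⟩ := exists_conj_localNonsplitEquiv_eq L (Matrix.of fun i j : Fin 3 => if i.val + j.val + 1 = 3 then (1 : L) else 0) v w hw hT (Subgroup.mul_mem _ (Subgroup.mul_mem _ hk hu) (Subgroup.inv_mem _ hk))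
  have hconj : IsConj γ γ₀ := (isConj_iff_exists_conj_localNonsplitEquiv L w hw γ γ₀).2 ⟨k, hk, hγ₀.symm⟩
  refine ⟨γ₀, ?_, hconj.symm⟩
  have h1 : (1 : GL (Fin 3) (w.1.adicCompletion L)) * ((localNonsplitEquiv (IsCMField.complexConj L) (Matrix.of fun i j : Fin 3 => if i.val + j.val + 1 = 3 then (1 : L) else 0) (IsCMField.complexConj_ne_one L) w hw γ₀ : ↥(unitaryGroupOfForm (galAdicCompletionMap (L := L) (IsCMField.complexConj L) hw) (placeForm (Matrix.of fun i j : Fin 3 => if i.val + j.val + 1 = 3 then (1 : L) else 0) w.1))) : GL (Fin 3) (w.1.adicCompletion L)) * (1 : GL (Fin 3) (w.1.adicCompletion L))⁻¹ = ((localNonsplitEquiv (IsCMField.complexConj L) (Matrix.of fun i j : Fin 3 => if i.val + j.val + 1 = 3 then (1 : L) else 0) (IsCMField.complexConj_ne_one L) w hw γ₀ : ↥(unitaryGroupOfForm (galAdicCompletionMap (L := L) (IsCMField.complexConj L) hw) (placeForm (Matrix.of fun i j : Fin 3 => if i.val + j.val + 1 = 3 then (1 : L) else 0) w.1))) : GL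 (Fin 3) (w.1.adicCompletion L)) := by
    rw [one_mul, inv_one, mul_one]
  rw [← h1, hγ₀]
  exact hk'

end WhichClass

/-! ## §3 (ED. 2) The case head `…_of_regular_unipotent` from the BASE-POINT finiteness -/

section CaseHead

set_option maxHeartbeats 400000 in
-- statement-heavy: four instance binders + the ∀-closed base-point hypothesis
/-- **THE REGULAR CASE OF THE RANGA-RAO CLAUSE FROM THE BASE-POINT FINITENESS.**  `hbase` = the μ-GENERIC finiteness at THE regular base point `u(1, −1∕2)` (to be the export of
§4 (ED. 3) over ★ (A) LH5-p02 `UnitaryGroup.exists_shells_of_regular_unipotent` + ★ (B) LH4-p03 `measure_biUnion_image_mk_mul_lt_top_of_shells'`, carried here as a HYPOTHESIS until they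
are ★): for `γ₀ ∈ G` with `ψ γ₀ = !![1, 1, −2⁻¹; 0, 1, −1; 0, 0, 1]` (`ψ` at `hw := smul_placesOver_eq_of_subsingleton …`), every `G`-invariant measure on `G ⧸ C(γ₀)` finite on compacta and
every compact `C ⊆ G`, `μ {yC(γ₀) ∣ y γ₀ y⁻¹ ∈ C} < ⊤`.  CONCLUSION = the case head of record `UnitaryGroup.integrable_descConj_of_isLocSmooth_of_regular_unipotent` (LH5-p02 (g2) 04:42:02Z
text ∀-closed: HCONV prefix, `(hγ : (γ−1)³ = 0) (hreg : (γ−1)² ≠ 0)`, then `μ`, `[inv] [fin]`, `f`, `hf`).  Proof: §2 «which class» (`(2 : L_w) ≠ 0` from `IsUnit (2 : 𝒪[L_w])`) + ★ p849303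
`integrable_descConj_of_isConj_of_forall_measure_preimage_lt_top` (LH10-p01: Rao finiteness transports along `IsConj`). [cite: Rao1972, Theorem p. 505]
[cite: Rogawski1990, §3.9 Prop. 3.9.1 p. 32; §4.9 p. 54; §8.1 p. 112] -/
theorem UnitaryGroup.integrable_descConj_of_isLocSmooth_of_regular_unipotent_of_basePoint
    (hbase : ∀ (L : Type) [Field L] [NumberField L] [IsCMField L] (v : HeightOneSpectrum (𝓞 ↥(maximalRealSubfield L))) (w : UnitaryGroup.PlacesOver L v)
      (hsub : Subsingleton (UnitaryGroup.PlacesOver L v)), IsUnit (2 : 𝒪[w.1.adicCompletion L]) →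
      ∀ [MeasurableSpace ((cmDatum L 3 (Matrix.of fun i j : Fin 3 => if i.val + j.val + 1 = 3 then (1 : L) else 0)).Local v)] [BorelSpace ((cmDatum L 3 (Matrix.of fun i j : Fin 3 => if i.val + j.val + 1 = 3 then (1 : L) else 0)).Local v)]
        [∀ γ : ((cmDatum L 3 (Matrix.of fun i j : Fin 3 => if i.val + j.val + 1 = 3 then (1 : L) else 0)).Local v), MeasurableSpace (((cmDatum L 3 (Matrix.of fun i j : Fin 3 => if i.val + j.val + 1 = 3 then (1 : L) else 0)).Local v) ⧸ Subgroup.centralizer ({γ} : Set ((cmDatum L 3 (Matrix.of fun i j : Fin 3 => if i.val + j.val + 1 = 3 then (1 : L) else 0)).Local v)))]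
        [∀ γ : ((cmDatum L 3 (Matrix.of fun i j : Fin 3 => if i.val + j.val + 1 = 3 then (1 : L) else 0)).Local v), BorelSpace (((cmDatum L 3 (Matrix.of fun i j : Fin 3 => if i.val + j.val + 1 = 3 then (1 : L) else 0)).Local v) ⧸ Subgroup.centralizer ({γ} : Set ((cmDatum L 3 (Matrix.of fun i j : Fin 3 => if i.val + j.val + 1 = 3 then (1 : L) else 0)).Local v)))],
      ∀ (γ₀ : ((cmDatum L 3 (Matrix.of fun i j : Fin 3 => if i.val + j.val + 1 = 3 then (1 : L) else 0)).Local v)),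
        ((((localNonsplitEquiv (IsCMField.complexConj L) (Matrix.of fun i j : Fin 3 => if i.val + j.val + 1 = 3 then (1 : L) else 0) (IsCMField.complexConj_ne_one L) w (smul_placesOver_eq_of_subsingleton L v (IsCMField.complexConj L) hsub w) γ₀ : ↥(unitaryGroupOfForm (galAdicCompletionMap (L := L) (IsCMField.complexConj L) (smul_placesOver_eq_of_subsingleton L v (IsCMField.complexConj L) hsub w)) (placeForm (Matrix.of fun i j : Fin 3 => if i.val + j.val + 1 = 3 then (1 : L) else 0) w.1))) : GL (Fin 3) (w.1.adicCompletion L))) : Matrix (Fin 3) (Fin 3) (w.1.adicCompletion L)) = !![1, 1, -2⁻¹; 0, 1, -1; 0, 0, 1] →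
      ∀ (μ : Measure (((cmDatum L 3 (Matrix.of fun i j : Fin 3 => if i.val + j.val + 1 = 3 then (1 : L) else 0)).Local v) ⧸ (Subgroup.centralizer ({γ₀} : Set ((cmDatum L 3 (Matrix.of fun i j : Fin 3 => if i.val + j.val + 1 = 3 then (1 : L) else 0)).Local v)))))
        [SMulInvariantMeasure ((cmDatum L 3 (Matrix.of fun i j : Fin 3 => if i.val + j.val + 1 = 3 then (1 : L) else 0)).Local v) (((cmDatum L 3 (Matrix.of fun i j : Fin 3 => if i.val + j.val + 1 = 3 then (1 : L) else 0)).Local v) ⧸ (Subgroup.centralizer ({γ₀} : Set ((cmDatum L 3 (Matrix.of fun i j : Fin 3 => if i.val + j.val + 1 = 3 then (1 : L) else 0)).Local v)))) μ] [IsFiniteMeasureOnCompacts μ] (C : Set ((cmDatum L 3 (Matrix.of fun i j : Fin 3 => if i.val + j.val + 1 = 3 then (1 : L) else 0)).Local v)), IsCompact C →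
        μ (descConj γ₀ (Subgroup.centralizer ({γ₀} : Set ((cmDatum L 3 (Matrix.of fun i j : Fin 3 => if i.val + j.val + 1 = 3 then (1 : L) else 0)).Local v))) (fun _ hg => Subgroup.mem_centralizer_singleton_iff.1 hg) id ⁻¹' C) < ⊤) :
    ∀ (L : Type) [Field L] [NumberField L] [IsCMField L] (v : HeightOneSpectrum (𝓞 ↥(maximalRealSubfield L))) (w : UnitaryGroup.PlacesOver L v),
      Subsingleton (UnitaryGroup.PlacesOver L v) → IsUnit (2 : 𝒪[w.1.adicCompletion L]) →
      ∀ [MeasurableSpace ((cmDatum L 3 (Matrix.of fun i j : Fin 3 => if i.val + j.val + 1 = 3 then (1 : L) else 0)).Local v)] [BorelSpace ((cmDatum L 3 (Matrix.of fun i j : Fin 3 => if i.val + j.val + 1 = 3 then (1 : L) else 0)).Local v)]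
        [∀ γ : ((cmDatum L 3 (Matrix.of fun i j : Fin 3 => if i.val + j.val + 1 = 3 then (1 : L) else 0)).Local v), MeasurableSpace (((cmDatum L 3 (Matrix.of fun i j : Fin 3 => if i.val + j.val + 1 = 3 then (1 : L) else 0)).Local v) ⧸ Subgroup.centralizer ({γ} : Set ((cmDatum L 3 (Matrix.of fun i j : Fin 3 => if i.val + j.val + 1 = 3 then (1 : L) else 0)).Local v)))]
        [∀ γ : ((cmDatum L 3 (Matrix.of fun i j : Fin 3 => if i.val + j.val + 1 = 3 then (1 : L) else 0)).Local v), BorelSpace (((cmDatum L 3 (Matrix.of fun i j : Fin 3 => if i.val + j.val + 1 = 3 then (1 : L) else 0)).Local v) ⧸ Subgroup.centralizer ({γ} : Set ((cmDatum L 3 (Matrix.of fun i j : Fin 3 => if i.val + j.val + 1 = 3 then (1 : L) else 0)).Local v)))],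
      ∀ (γ : ((cmDatum L 3 (Matrix.of fun i j : Fin 3 => if i.val + j.val + 1 = 3 then (1 : L) else 0)).Local v)), ((γ.val : GL (Fin 3) (UnitaryGroup.LocalRing L v)).val - 1) ^ 3 = 0 → ((γ.val : GL (Fin 3) (UnitaryGroup.LocalRing L v)).val - 1) ^ 2 ≠ 0 →
        ∀ (μ : Measure (((cmDatum L 3 (Matrix.of fun i j : Fin 3 => if i.val + j.val + 1 = 3 then (1 : L) else 0)).Local v) ⧸ (Subgroup.centralizer ({γ} : Set ((cmDatum L 3 (Matrix.of fun i j : Fin 3 => if i.val + j.val + 1 = 3 then (1 : L) else 0)).Local v)))))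
          [SMulInvariantMeasure ((cmDatum L 3 (Matrix.of fun i j : Fin 3 => if i.val + j.val + 1 = 3 then (1 : L) else 0)).Local v) (((cmDatum L 3 (Matrix.of fun i j : Fin 3 => if i.val + j.val + 1 = 3 then (1 : L) else 0)).Local v) ⧸ (Subgroup.centralizer ({γ} : Set ((cmDatum L 3 (Matrix.of fun i j : Fin 3 => if i.val + j.val + 1 = 3 then (1 : L) else 0)).Local v)))) μ] [IsFiniteMeasureOnCompacts μ],
        ∀ f : ((cmDatum L 3 (Matrix.of fun i j : Fin 3 => if i.val + j.val + 1 = 3 then (1 : L) else 0)).Local v) → ℂ, IsLocSmooth f →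
          Integrable (descConj γ (Subgroup.centralizer ({γ} : Set ((cmDatum L 3 (Matrix.of fun i j : Fin 3 => if i.val + j.val + 1 = 3 then (1 : L) else 0)).Local v))) (fun _ hg => Subgroup.mem_centralizer_singleton_iff.1 hg) f) μ := by
  intro L _ _ _ v w hsub h2 _ _ _ _ γ hγ hreg μ _ _ f hf
  have h2K : (2 : w.1.adicCompletion L) ≠ 0 := by
    have h := h2.map (algebraMap (𝒪[w.1.adicCompletion L]) (w.1.adicCompletion L))
    rw [map_ofNat] at h
    exact h.ne_zero
  obtain ⟨γ₀, hψ, hc⟩ := exists_isConj_localNonsplitEquiv_eq_regularUnipotentNormalForm L w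
    (smul_placesOver_eq_of_subsingleton L v (IsCMField.complexConj L) hsub w) hsub h2K γ hγ hreg
  exact integrable_descConj_of_isConj_of_forall_measure_preimage_lt_top
    (fun μ₀ _ _ C hC => hbase L v w hsub h2 γ₀ hψ μ₀ C hC) hc μ hf.isLocallyConstant.continuous hf.hasCompactSupport

end CaseHead


/-! ## §4 (ED. 3) The base-point finiteness from ★ (A) + ★ (B), and THE CASE HEAD OF RECORD -/

section Heads

set_option maxHeartbeats 400000 in
-- statement-heavy: the `hbase` text
/-- **THE BASE-POINT FINITENESS `hbase` (the hypothesis of §3, now PROVED): for `γ₀ ∈ U(Φ₃)(L⁺_v)` with `ψ γ₀ = u(1, −1∕2)`, every `G`-invariant measure `μ` on `G ⧸ C(γ₀)` finite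
on compacta and every compact `C ⊆ G`, `μ {yC(γ₀) ∣ y γ₀ y⁻¹ ∈ C} < ⊤`.**  Proof: ★ (A) LH5-p02 `UnitaryGroup.exists_shells_of_regular_unipotent` (shells at the base point, `t₀ := 2⁻¹`,
`hw := smul_placesOver_eq_of_subsingleton …`) ⟶ ★ (B)′ LH4-p03 `measure_biUnion_image_mk_mul_lt_top_of_shells'` at `H := C(γ₀)` (closed), `K := U(Φ₃)(𝒪_v)` (★
`isCompact_isOpen_cmLocalIntegralLevel`), `ν := Measure.haar` (right-invariant: ★ `isMulRightInvariant_cmDatum_local_antidiagOne`) ⟶ monotonicity (`(descConj γ₀ C(γ₀) id)⁻¹(C)` is the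
image of `{y ∣ yγ₀y⁻¹ ∈ C}`, and the right `C(γ₀)`-saturation of the covering sets dies under `QuotientGroup.mk`). [cite: Rao1972, Theorem p. 505] [cite: Rogawski1990, §8.1 p. 112; §4.9 p. 54] -/
theorem UnitaryGroup.measure_preimage_descConj_lt_top_of_regular_basePoint :
    ∀ (L : Type) [Field L] [NumberField L] [IsCMField L] (v : HeightOneSpectrum (𝓞 ↥(maximalRealSubfield L))) (w : UnitaryGroup.PlacesOver L v)
      (hsub : Subsingleton (UnitaryGroup.PlacesOver L v)), IsUnit (2 : 𝒪[w.1.adicCompletion L]) →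
      ∀ [MeasurableSpace ((cmDatum L 3 (Matrix.of fun i j : Fin 3 => if i.val + j.val + 1 = 3 then (1 : L) else 0)).Local v)] [BorelSpace ((cmDatum L 3 (Matrix.of fun i j : Fin 3 => if i.val + j.val + 1 = 3 then (1 : L) else 0)).Local v)]
        [∀ γ : ((cmDatum L 3 (Matrix.of fun i j : Fin 3 => if i.val + j.val + 1 = 3 then (1 : L) else 0)).Local v), MeasurableSpace (((cmDatum L 3 (Matrix.of fun i j : Fin 3 => if i.val + j.val + 1 = 3 then (1 : L) else 0)).Local v) ⧸ Subgroup.centralizer ({γ} : Set ((cmDatum L 3 (Matrix.of fun i j : Fin 3 => if i.val + j.val + 1 = 3 then (1 : L) else 0)).Local v)))]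
        [∀ γ : ((cmDatum L 3 (Matrix.of fun i j : Fin 3 => if i.val + j.val + 1 = 3 then (1 : L) else 0)).Local v), BorelSpace (((cmDatum L 3 (Matrix.of fun i j : Fin 3 => if i.val + j.val + 1 = 3 then (1 : L) else 0)).Local v) ⧸ Subgroup.centralizer ({γ} : Set ((cmDatum L 3 (Matrix.of fun i j : Fin 3 => if i.val + j.val + 1 = 3 then (1 : L) else 0)).Local v)))],
      ∀ (γ₀ : ((cmDatum L 3 (Matrix.of fun i j : Fin 3 => if i.val + j.val + 1 = 3 then (1 : L) else 0)).Local v)),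
        ((((localNonsplitEquiv (IsCMField.complexConj L) (Matrix.of fun i j : Fin 3 => if i.val + j.val + 1 = 3 then (1 : L) else 0) (IsCMField.complexConj_ne_one L) w (smul_placesOver_eq_of_subsingleton L v (IsCMField.complexConj L) hsub w) γ₀ : ↥(unitaryGroupOfForm (galAdicCompletionMap (L := L) (IsCMField.complexConj L) (smul_placesOver_eq_of_subsingleton L v (IsCMField.complexConj L) hsub w)) (placeForm (Matrix.of fun i j : Fin 3 => if i.val + j.val + 1 = 3 then (1 : L) else 0) w.1))) : GL (Fin 3) (w.1.adicCompletion L))) : Matrix (Fin 3) (Fin 3) (w.1.adicCompletion L)) = !![1, 1, -2⁻¹; 0, 1, -1; 0, 0, 1] →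
      ∀ (μ : Measure (((cmDatum L 3 (Matrix.of fun i j : Fin 3 => if i.val + j.val + 1 = 3 then (1 : L) else 0)).Local v) ⧸ (Subgroup.centralizer ({γ₀} : Set ((cmDatum L 3 (Matrix.of fun i j : Fin 3 => if i.val + j.val + 1 = 3 then (1 : L) else 0)).Local v)))))
        [SMulInvariantMeasure ((cmDatum L 3 (Matrix.of fun i j : Fin 3 => if i.val + j.val + 1 = 3 then (1 : L) else 0)).Local v) (((cmDatum L 3 (Matrix.of fun i j : Fin 3 => if i.val + j.val + 1 = 3 then (1 : L) else 0)).Local v) ⧸ (Subgroup.centralizer ({γ₀} : Set ((cmDatum L 3 (Matrix.of fun i j : Fin 3 => if i.val + j.val + 1 = 3 then (1 : L) else 0)).Local v)))) μ] [IsFiniteMeasureOnCompacts μ] (C : Set ((cmDatum L 3 (Matrix.of fun i j : Fin 3 => if i.val + j.val + 1 = 3 then (1 : L) else 0)).Local v)), IsCompact C →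
        μ (descConj γ₀ (Subgroup.centralizer ({γ₀} : Set ((cmDatum L 3 (Matrix.of fun i j : Fin 3 => if i.val + j.val + 1 = 3 then (1 : L) else 0)).Local v))) (fun _ hg => Subgroup.mem_centralizer_singleton_iff.1 hg) id ⁻¹' C) < ⊤ := by
  intro L _ _ _ v w hsub h2 _ _ _ _ γ₀ hγ₀ μ _ _ C hC
  obtain ⟨j₀, N, x, S, c₃, -, -, hSc, hS₀, hle, habs, hgr, hcov⟩ :=
    UnitaryGroup.exists_shells_of_regular_unipotent L v w (smul_placesOver_eq_of_subsingleton L v (IsCMField.complexConj L) hsub w) h2 γ₀ hγ₀ C hC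
  have hK := isCompact_isOpen_cmLocalIntegralLevel L 3 (Matrix.of fun i j : Fin 3 => if i.val + j.val + 1 = 3 then (1 : L) else 0) v
  haveI : IsClosed (((Subgroup.centralizer ({γ₀} : Set ((cmDatum L 3 (Matrix.of fun i j : Fin 3 => if i.val + j.val + 1 = 3 then (1 : L) else 0)).Local v))) : Subgroup ((cmDatum L 3 (Matrix.of fun i j : Fin 3 => if i.val + j.val + 1 = 3 then (1 : L) else 0)).Local v)) : Set ((cmDatum L 3 (Matrix.of fun i j : Fin 3 => if i.val + j.val + 1 = 3 then (1 : L) else 0)).Local v)) := Set.isClosed_centralizer _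
  haveI := isMulRightInvariant_cmDatum_local_antidiagOne L 3 v
    (Measure.haar : Measure ((cmDatum L 3 (Matrix.of fun i j : Fin 3 => if i.val + j.val + 1 = 3 then (1 : L) else 0)).Local v))
  have hbound := measure_biUnion_image_mk_mul_lt_top_of_shells' (Subgroup.centralizer ({γ₀} : Set ((cmDatum L 3 (Matrix.of fun i j : Fin 3 => if i.val + j.val + 1 = 3 then (1 : L) else 0)).Local v))) μ (Measure.haar : Measure ((cmDatum L 3 (Matrix.of fun i j : Fin 3 => if i.val + j.val + 1 = 3 then (1 : L) else 0)).Local v)) (cmLocalIntegralLevel L 3 (Matrix.of fun i j : Fin 3 => if i.val + j.val + 1 = 3 then (1 : L) else 0) v) hK.2 hK.1 j₀ N x S c₃ hSc hS₀ hle habs hgr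
  refine lt_of_le_of_lt (measure_mono ?_) hbound
  intro y hy
  induction y using QuotientGroup.induction_on with
  | H g =>
    have hg : g ∈ {y : ((cmDatum L 3 (Matrix.of fun i j : Fin 3 => if i.val + j.val + 1 = 3 then (1 : L) else 0)).Local v) | y * γ₀ * y⁻¹ ∈ C} := hy
    have hg' := hcov hg
    simp only [mem_iUnion, mem_setOf_eq, exists_prop] at hg'
    obtain ⟨j, hj, q, hq, hmem⟩ := hg'
    obtain ⟨a, ha, c, hc, rfl⟩ := Set.mem_mul.1 hmem
    simp only [mem_iUnion, mem_setOf_eq, exists_prop]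
    refine ⟨j, hj, q, hq, a, ha, ?_⟩
    exact (QuotientGroup.mk_mul_of_mem a hc).symm

set_option maxHeartbeats 400000 in
-- statement-heavy: four instance binders
/-- **THE REGULAR CASE, MEASURE LEVEL**: for every REGULAR unipotent `γ ∈ U(Φ₃)(L⁺_v)` (`(γ − 1)³ = 0 ≠ (γ − 1)²`, odd non-split `v`), every `G`-invariant measure `μ` on `G ⧸ C(γ)` finite on
compacta and every compact `C ⊆ G`, `μ {yC(γ) ∣ y γ y⁻¹ ∈ C} < ⊤` (§2 «which class» + the base-point finiteness + ★ p849303 `measure_preimage_descConj_lt_top_of_isConj`).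
[cite: Rao1972, Theorem p. 505] [cite: Rogawski1990, §3.9 Prop. 3.9.1 p. 32; §4.9 p. 54; §8.1 p. 112] -/
theorem UnitaryGroup.measure_preimage_descConj_lt_top_of_regular_unipotent
    (L : Type) [Field L] [NumberField L] [IsCMField L] (v : HeightOneSpectrum (𝓞 ↥(maximalRealSubfield L))) (w : UnitaryGroup.PlacesOver L v)
    (hsub : Subsingleton (UnitaryGroup.PlacesOver L v)) (h2 : IsUnit (2 : 𝒪[w.1.adicCompletion L]))
    [MeasurableSpace ((cmDatum L 3 (Matrix.of fun i j : Fin 3 => if i.val + j.val + 1 = 3 then (1 : L) else 0)).Local v)] [BorelSpace ((cmDatum L 3 (Matrix.of fun i j : Fin 3 => if i.val + j.val + 1 = 3 then (1 : L) else 0)).Local v)]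
    [∀ γ : ((cmDatum L 3 (Matrix.of fun i j : Fin 3 => if i.val + j.val + 1 = 3 then (1 : L) else 0)).Local v), MeasurableSpace (((cmDatum L 3 (Matrix.of fun i j : Fin 3 => if i.val + j.val + 1 = 3 then (1 : L) else 0)).Local v) ⧸ Subgroup.centralizer ({γ} : Set ((cmDatum L 3 (Matrix.of fun i j : Fin 3 => if i.val + j.val + 1 = 3 then (1 : L) else 0)).Local v)))]
    [∀ γ : ((cmDatum L 3 (Matrix.of fun i j : Fin 3 => if i.val + j.val + 1 = 3 then (1 : L) else 0)).Local v), BorelSpace (((cmDatum L 3 (Matrix.of fun i j : Fin 3 => if i.val + j.val + 1 = 3 then (1 : L) else 0)).Local v) ⧸ Subgroup.centralizer ({γ} : Set ((cmDatum L 3 (Matrix.of fun i j : Fin 3 => if i.val + j.val + 1 = 3 then (1 : L) else 0)).Local v)))]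
    (γ : ((cmDatum L 3 (Matrix.of fun i j : Fin 3 => if i.val + j.val + 1 = 3 then (1 : L) else 0)).Local v)) (hγ : ((γ.val : GL (Fin 3) (UnitaryGroup.LocalRing L v)).val - 1) ^ 3 = 0) (hreg : ((γ.val : GL (Fin 3) (UnitaryGroup.LocalRing L v)).val - 1) ^ 2 ≠ 0)
    (μ : Measure (((cmDatum L 3 (Matrix.of fun i j : Fin 3 => if i.val + j.val + 1 = 3 then (1 : L) else 0)).Local v) ⧸ (Subgroup.centralizer ({γ} : Set ((cmDatum L 3 (Matrix.of fun i j : Fin 3 => if i.val + j.val + 1 = 3 then (1 : L) else 0)).Local v)))))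
    [SMulInvariantMeasure ((cmDatum L 3 (Matrix.of fun i j : Fin 3 => if i.val + j.val + 1 = 3 then (1 : L) else 0)).Local v) (((cmDatum L 3 (Matrix.of fun i j : Fin 3 => if i.val + j.val + 1 = 3 then (1 : L) else 0)).Local v) ⧸ (Subgroup.centralizer ({γ} : Set ((cmDatum L 3 (Matrix.of fun i j : Fin 3 => if i.val + j.val + 1 = 3 then (1 : L) else 0)).Local v)))) μ] [IsFiniteMeasureOnCompacts μ]
    (C : Set ((cmDatum L 3 (Matrix.of fun i j : Fin 3 => if i.val + j.val + 1 = 3 then (1 : L) else 0)).Local v)) (hC : IsCompact C) :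
    μ ((descConj γ (Subgroup.centralizer ({γ} : Set ((cmDatum L 3 (Matrix.of fun i j : Fin 3 => if i.val + j.val + 1 = 3 then (1 : L) else 0)).Local v))) (fun _ hg => Subgroup.mem_centralizer_singleton_iff.1 hg) id) ⁻¹' C) < ⊤ := by
  have h2K : (2 : w.1.adicCompletion L) ≠ 0 := by
    have h := h2.map (algebraMap (𝒪[w.1.adicCompletion L]) (w.1.adicCompletion L))
    rw [map_ofNat] at h
    exact h.ne_zero
  obtain ⟨γ₀, hψ, hc⟩ := exists_isConj_localNonsplitEquiv_eq_regularUnipotentNormalForm L w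
    (smul_placesOver_eq_of_subsingleton L v (IsCMField.complexConj L) hsub w) hsub h2K γ hγ hreg
  exact measure_preimage_descConj_lt_top_of_isConj
    (fun μ₀ _ _ C' hC' => UnitaryGroup.measure_preimage_descConj_lt_top_of_regular_basePoint L v w hsub h2 γ₀ hψ μ₀ C' hC') hc μ hC

set_option maxHeartbeats 400000 in
-- statement-heavy: four instance binders
/-- **THE REGULAR CASE OF RANGA-RAO'S CLAUSE — CASE HEAD OF RECORD `UnitaryGroup.integrable_descConj_of_isLocSmooth_of_regular_unipotent`** (LH5-p02 (g2) 04:42:02Z text; binders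
`(L)(v)(w)(hsub)(h2)[4 inst](γ)(hγ)(hreg)(μ)[inv][fin](f)(hf)`): for a REGULAR unipotent `γ ∈ U(Φ₃)(L⁺_v)` at an odd non-split place, every `G`-invariant measure `μ` on `G ⧸ C(γ)` finite on
compacta and every `f ∈ C_c^∞(G)`, the orbital integrand `y C(γ) ↦ f(y γ y⁻¹)` is `μ`-integrable.  Proof: §3 `…_of_basePoint` fed with §4 `…_of_regular_basePoint` — i.e. ★ Prop. 3.9.1 normal form
+ ★ (A) shells (LH5-p02, over ★ p849367 (I) F0P3a-p09, ★ p849437 (II-S) LH7-p03, ★ p849305∕p849366) + ★ (B) shell sum (LH4-p03, over ★ p849197 F0P3a-p09) + ★ p849303 transport (LH10-p01).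
[cite: Rao1972, Theorem p. 505] [cite: Rogawski1990, §3.9 Prop. 3.9.1 p. 32; §4.9 p. 54; §8.1 p. 112] [cite: HarishChandra1999AdmissibleDistributions, §3.1 p. 17] -/
theorem UnitaryGroup.integrable_descConj_of_isLocSmooth_of_regular_unipotent
    (L : Type) [Field L] [NumberField L] [IsCMField L] (v : HeightOneSpectrum (𝓞 ↥(maximalRealSubfield L))) (w : UnitaryGroup.PlacesOver L v)
    (hsub : Subsingleton (UnitaryGroup.PlacesOver L v)) (h2 : IsUnit (2 : 𝒪[w.1.adicCompletion L]))
    [MeasurableSpace ((cmDatum L 3 (Matrix.of fun i j : Fin 3 => if i.val + j.val + 1 = 3 then (1 : L) else 0)).Local v)] [BorelSpace ((cmDatum L 3 (Matrix.of fun i j : Fin 3 => if i.val + j.val + 1 = 3 then (1 : L) else 0)).Local v)]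
    [∀ γ : ((cmDatum L 3 (Matrix.of fun i j : Fin 3 => if i.val + j.val + 1 = 3 then (1 : L) else 0)).Local v), MeasurableSpace (((cmDatum L 3 (Matrix.of fun i j : Fin 3 => if i.val + j.val + 1 = 3 then (1 : L) else 0)).Local v) ⧸ Subgroup.centralizer ({γ} : Set ((cmDatum L 3 (Matrix.of fun i j : Fin 3 => if i.val + j.val + 1 = 3 then (1 : L) else 0)).Local v)))]
    [∀ γ : ((cmDatum L 3 (Matrix.of fun i j : Fin 3 => if i.val + j.val + 1 = 3 then (1 : L) else 0)).Local v), BorelSpace (((cmDatum L 3 (Matrix.of fun i j : Fin 3 => if i.val + j.val + 1 = 3 then (1 : L) else 0)).Local v) ⧸ Subgroup.centralizer ({γ} : Set ((cmDatum L 3 (Matrix.of fun i j : Fin 3 => if i.val + j.val + 1 = 3 then (1 : L) else 0)).Local v)))]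
    (γ : ((cmDatum L 3 (Matrix.of fun i j : Fin 3 => if i.val + j.val + 1 = 3 then (1 : L) else 0)).Local v)) (hγ : ((γ.val : GL (Fin 3) (UnitaryGroup.LocalRing L v)).val - 1) ^ 3 = 0) (hreg : ((γ.val : GL (Fin 3) (UnitaryGroup.LocalRing L v)).val - 1) ^ 2 ≠ 0)
    (μ : Measure (((cmDatum L 3 (Matrix.of fun i j : Fin 3 => if i.val + j.val + 1 = 3 then (1 : L) else 0)).Local v) ⧸ (Subgroup.centralizer ({γ} : Set ((cmDatum L 3 (Matrix.of fun i j : Fin 3 => if i.val + j.val + 1 = 3 then (1 : L) else 0)).Local v)))))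
    [SMulInvariantMeasure ((cmDatum L 3 (Matrix.of fun i j : Fin 3 => if i.val + j.val + 1 = 3 then (1 : L) else 0)).Local v) (((cmDatum L 3 (Matrix.of fun i j : Fin 3 => if i.val + j.val + 1 = 3 then (1 : L) else 0)).Local v) ⧸ (Subgroup.centralizer ({γ} : Set ((cmDatum L 3 (Matrix.of fun i j : Fin 3 => if i.val + j.val + 1 = 3 then (1 : L) else 0)).Local v)))) μ] [IsFiniteMeasureOnCompacts μ]
    (f : ((cmDatum L 3 (Matrix.of fun i j : Fin 3 => if i.val + j.val + 1 = 3 then (1 : L) else 0)).Local v) → ℂ) (hf : IsLocSmooth f) :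
    Integrable (descConj γ (Subgroup.centralizer ({γ} : Set ((cmDatum L 3 (Matrix.of fun i j : Fin 3 => if i.val + j.val + 1 = 3 then (1 : L) else 0)).Local v))) (fun _ hg => Subgroup.mem_centralizer_singleton_iff.1 hg) f) μ :=
  UnitaryGroup.integrable_descConj_of_isLocSmooth_of_regular_unipotent_of_basePoint
    UnitaryGroup.measure_preimage_descConj_lt_top_of_regular_basePoint L v w hsub h2 γ hγ hreg μ f hf

end Heads

end Literature.NumberTheory.Rogawski1990

end
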